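import Summits.ResolutionOfSingularities.ResolutionOfSingularities.Theorems.FrobeniusLadderFInjectiveMacaulayficationRelClosedSubsetFixFinite
import Summits.ResolutionOfSingularities.ResolutionOfSingularities.Theorems.FrobeniusLadderFInjectiveMacaulayficationFCUnguardedLocDimLe3
import Summits.ResolutionOfSingularities.ResolutionOfSingularities.Theorems.FrobeniusLadderFInjectiveMacaulayficationFCUnguardedFiniteResidual
import Literature.AlgebraicGeometry.Resolution.CanonicalResolutionSmoothCentre
import HarnessLib

/-!
# (T3ʳ)/(T3-finʳ): the closed-point relative fix and its finite iteration in the REPAIRED currency (goodness over a whole punctured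
# open neighbourhood, agreement up to a power), and FC″ at a non-closed bad point whose spread residual is finite — after the M2 kill
# (crux `FInjectiveMacaulayfication` stmt-ResolutionOfSingularities-15315, chain w45a; res-L1-w45a-plan-1 R16.33 (3)–(4) «stub-1: NEW FILE `…RelClosedFixR.lean`»;
# texts posted for AGREE 22:00Z; res-L1-w45a-tri-2 KILL-T3CLOSED.md (M2 witness, repaired shapes); seat res-L1-w45a-stub-1 g6)

[OURS · L1 W4.5a] Support file (`--supports stmt-ResolutionOfSingularities-15315 --as helper`); NOT a statement of any manuscript;
AI-written (AI review is weaker than expert review). Three `@[conjecture] def`s (CANDIDATE statements of OURS, consumed only as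
hypotheses/targets; nothing here is a Literature fact) and sorry-free kernels; no named facts.

WHY (plan-1 R16.33 after tri-2's elementary witness, mechanism M2). v0.7's (T3) `RelClosedSubsetFixFinite.RelClosedFix` and (T3-fin)
`RelClosedSubsetFixFinite` (p569490) are FALSE AS TYPED: their hypothesis `GoodOver J₀ (supp J₀ ∩ …)` lets the datum ignore a bad stratum `B ⊄
supp J₀` crossing `supp J₀` at the marked closed point `b` (`X₁ = W × 𝔸²`, `J₀ = I_C`, `C ∩ B = {b}`), while every cure pinned to `J₀` off
`b` inherits NON-closed bad points over `b` on the strict transform of `B`. JUNK RULE M2: hypotheses must state goodness over a WHOLE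
(punctured) OPEN SET; conclusions `GoodOver J S`, `S ⊆ supp J`, are harmless. This file re-types the two statements accordingly, in POWER
currency from the start (rule M1 = COR W′ does not bite at closed points: a cure need NOT dominate `Bl_{J₀}`), ports the finite iteration,
and books the surviving positive consequence for hole #3: FC″ at every non-closed bad point whose (A′) datum spreads with a FINITE residual
inside an open set over which the spread is good.

* (T3ʳ) `RelClosedFixR` — at a closed `b ∈ supp J₀`, if EVERY blow-up along `J₀` is good over the punctured open `W ∖ {b}` (`W ∋ b` open),
  then some `J ≡ J₀ⁿ` off `b` (`n > 0`) is good over a whole open `W′ ∋ b`. NO `b ∈ supp J` conjunct (the iteration never consumes it;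
  keeping it would force a `b`-supported cure when `J₀,b` is `𝔪_b`-primary — the refuted-for-surfaces 5e shape). Trivial when `J₀,b` is
  invertible (`J := J₀`); content = `J₀,b` not invertible with bad points of `Bl_{J₀}` over `b`. OPEN; candidate; possibly stronger than
  the summit (a pinned cure is not implied by a resolution of `X₁`) — LINE-internal, not a door stub.
* (T3-finʳ) `RelClosedSubsetFixFiniteR` — finite `Z ⊆ supp J₀ ⊆ U` (`U` OPEN), `J₀` good over `U ∖ Z` ⇒ some `J ≡ J₀ⁿ` off `Z` good over `U`.
* `relClosedSubsetFixFiniteR_of_relClosedFixR : RelClosedFixR → RelClosedSubsetFixFiniteR` — finset induction; transport of goodness along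
  power-agreement off a closed set = p569490's `goodOver_of_stalkIdeal_eq_pow_off_closed` (its lemmas are sound; only its defs died).
* `FCUnguardedOfFiniteResidualR` — `FCUnguardedRungs.FCUnguardedDimGe4` VERBATIM + ONE hypothesis at `η`: «some (A′) datum `c′` spreads to
  `J₀` with a finite closed `Z ⊆ supp J₀ ⊆ V`, `η ∉ Z`, `V` open, `GoodOver p X₁ J₀ (V ∖ Z)`»; `fcUnguardedOfFiniteResidualR_of_finiteR :
  RelClosedSubsetFixFiniteR → FCUnguardedOfFiniteResidualR` (the datum for `J_η = (c′)ⁿ` is the monomial datum, res-L1-w45a-stub-3's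
  `FCUnguardedLocDimLe3.locFixData_pow`), `fcUnguardedOfFiniteResidualR_of_relClosedFixR`, and the sanity weakening
  `fcUnguardedOfFiniteResidualR_of_fcUnguardedDimGe4`.
[folklore assembly]
-/

-- single-problem summit: the doubled namespace component is forced
set_option linter.dupNamespace false

noncomputable section

open AlgebraicGeometry CategoryTheory Literature.AlgebraicGeometry.Resolution TopologicalSpace IsLocalRing

namespace Summit.ResolutionOfSingularities.ResolutionOfSingularities.Theorems.FInjectiveMacaulayfication.RelClosedFixR

open Summit.ResolutionOfSingularities.ResolutionOfSingularities.Theorems.FInjectiveMacaulayfication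
open Summit.ResolutionOfSingularities.ResolutionOfSingularities.Theorems.FInjectiveMacaulayfication.SliceableCentre (CMCl FCl FullCl)
open Summit.ResolutionOfSingularities.ResolutionOfSingularities.Theorems.FInjectiveMacaulayfication.FCUnguardedAprime (GoodOver LocFixData)

/-! ## §1 The repaired statements -/

/-- [OURS · CANDIDATE statement, not a fact] **(T3ʳ) relative closed-point fix, repaired currency** (plan-1 R16.33 (4) / tri-2 KILL-T3CLOSED §4):
at a closed point `b ∈ supp J₀` such that every blow-up along `J₀` is good over the WHOLE punctured open neighbourhood `W ∖ {b}`, some `J`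
agreeing with a POWER `J₀ⁿ` (`n > 0`) at every stalk `≠ b` is good over an open `W′ ∋ b`. Why it might fail / be too strong: see the
module docstring (content = `J₀,b` not invertible with bad points of `Bl_{J₀}` in the fibre over `b`; a pinned cure is not implied by a
resolution). Junk: `J₀,b` invertible ⇒ `J := J₀`, `n = 1`, `W′ := W` (the only point over `b` is `b`, closed, CM). [candidate statement,
OURS; open] -/
@[conjecture] def RelClosedFixR : Prop :=
  ∀ (p : ℕ), p.Prime → ∀ (k : Type) [Field k] [CharP k p]
    (X₁ : Scheme.{0}) (f₁ : X₁ ⟶ Spec (.of k)),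
      IsSeparated f₁ → LocallyOfFiniteType f₁ → QuasiCompact f₁ → IsIntegral X₁ → 4 ≤ topologicalKrullDim X₁ →
      (∀ x : X₁, CMCl (X₁.presheaf.stalk x)) →
      ∀ (J₀ : X₁.IdealSheafData) (b : X₁) (W : X₁.Opens), IsClosed ({b} : Set X₁) → b ∈ (J₀.support : Set X₁) → b ∈ (W : Set X₁) →
        GoodOver p X₁ J₀ ((W : Set X₁) \ {b}) →
        ∃ (J : X₁.IdealSheafData) (n : ℕ) (W' : X₁.Opens), 0 < n ∧ b ∈ (W' : Set X₁) ∧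
          (∀ x : X₁, x ≠ b → stalkIdeal J x = stalkIdeal J₀ x ^ n) ∧ GoodOver p X₁ J (W' : Set X₁)

/-- [OURS · CANDIDATE statement, not a fact] **(T3-finʳ) relative fix over a FINITE closed set, repaired currency**: `Z ⊆ supp J₀ ⊆ U` with
`Z` finite closed and `U` OPEN, every blow-up along `J₀` good over `U ∖ Z` ⇒ some `J ≡ J₀ⁿ` off `Z` (`n > 0`) is good over all of `U`.
PROVED below from (T3ʳ) (`relClosedSubsetFixFiniteR_of_relClosedFixR`). [candidate statement, OURS] -/
@[conjecture] def RelClosedSubsetFixFiniteR : Prop :=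
  ∀ (p : ℕ), p.Prime → ∀ (k : Type) [Field k] [CharP k p]
    (X₁ : Scheme.{0}) (f₁ : X₁ ⟶ Spec (.of k)),
      IsSeparated f₁ → LocallyOfFiniteType f₁ → QuasiCompact f₁ → IsIntegral X₁ → 4 ≤ topologicalKrullDim X₁ →
      (∀ x : X₁, CMCl (X₁.presheaf.stalk x)) →
      ∀ (J₀ : X₁.IdealSheafData) (Z : Set X₁) (U : X₁.Opens), IsClosed Z → Z.Finite → Z ⊆ (J₀.support : Set X₁) →
        (J₀.support : Set X₁) ⊆ (U : Set X₁) → GoodOver p X₁ J₀ ((U : Set X₁) \ Z) →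
        ∃ (J : X₁.IdealSheafData) (n : ℕ), 0 < n ∧ (∀ x : X₁, x ∉ Z → stalkIdeal J x = stalkIdeal J₀ x ^ n) ∧
          GoodOver p X₁ J (U : Set X₁)

/-! ## §2 (T3-finʳ) ⟸ (T3ʳ): finite iteration -/

/-- `GoodOver` over a union. [plumbing] -/
theorem goodOver_union {X₁ : Scheme.{0}} {p : ℕ} {J : X₁.IdealSheafData} {S S' : Set X₁} (h : GoodOver p X₁ J S) (h' : GoodOver p X₁ J S') :
    GoodOver p X₁ J (S ∪ S') := fun X₂ π hπ =>
  ⟨fun x hx hxcl => hx.elim (fun hx => (h X₂ π hπ).1 x hx hxcl) (fun hx => (h' X₂ π hπ).1 x hx hxcl),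
    fun x hx hxcl => hx.elim (fun hx => (h X₂ π hπ).2 x hx hxcl) (fun hx => (h' X₂ π hπ).2 x hx hxcl)⟩

/-- A power `n > 0` of a stalk ideal is proper iff the ideal is (local ring). [plumbing] -/
theorem pow_le_maximalIdeal_of_le {A : Type} [CommRing A] [IsLocalRing A] {I : Ideal A} (h : I ≤ maximalIdeal A) {n : ℕ} (hn : 0 < n) :
    I ^ n ≤ maximalIdeal A :=
  (Ideal.pow_le_self (Nat.pos_iff_ne_zero.mp hn)).trans h

/-- **THE FINITE ITERATION** in the repaired currency: curing the points of a finite `Z ⊆ supp J₀ ⊆ U` one at a time by (T3ʳ).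
Invariant after curing `s ⊆ Z`: `J ≡ J₀ⁿ` off `s`, and `J` is good over `(U ∖ Z) ∪ V` for an open `V ⊇ s`. [folklore assembly, OURS] -/
theorem iterate {X₁ : Scheme.{0}} [IsLocallyNoetherian X₁] [JacobsonSpace X₁] {p : ℕ}
    (hfix : ∀ (J₀ : X₁.IdealSheafData) (b : X₁) (W : X₁.Opens), IsClosed ({b} : Set X₁) → b ∈ (J₀.support : Set X₁) →
      b ∈ (W : Set X₁) → GoodOver p X₁ J₀ ((W : Set X₁) \ {b}) →
      ∃ (J : X₁.IdealSheafData) (n : ℕ) (W' : X₁.Opens), 0 < n ∧ b ∈ (W' : Set X₁) ∧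
        (∀ x : X₁, x ≠ b → stalkIdeal J x = stalkIdeal J₀ x ^ n) ∧ GoodOver p X₁ J (W' : Set X₁))
    (J₀ : X₁.IdealSheafData) (Z : Set X₁) (U : X₁.Opens) (hZcl : ∀ b ∈ Z, IsClosed ({b} : Set X₁)) (hZfin : Z.Finite)
    (hZsub : Z ⊆ (J₀.support : Set X₁)) (hJU : (J₀.support : Set X₁) ⊆ (U : Set X₁)) (hgood : GoodOver p X₁ J₀ ((U : Set X₁) \ Z))
    (s : Finset X₁) (hs : (s : Set X₁) ⊆ Z) :
    ∃ (J : X₁.IdealSheafData) (n : ℕ) (V : X₁.Opens), 0 < n ∧ (s : Set X₁) ⊆ (V : Set X₁) ∧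
      (∀ x : X₁, x ∉ (s : Set X₁) → stalkIdeal J x = stalkIdeal J₀ x ^ n) ∧ GoodOver p X₁ J (((U : Set X₁) \ Z) ∪ (V : Set X₁)) := by
  classical
  induction s using Finset.induction_on with
  | empty =>
    refine ⟨J₀, 1, ⊥, Nat.one_pos, by simp, fun x _ => by rw [pow_one], ?_⟩
    have he : ((U : Set X₁) \ Z) ∪ ((⊥ : X₁.Opens) : Set X₁) = (U : Set X₁) \ Z := by simp
    rw [he]
    exact hgood
  | @insert b s hbs ih =>
    obtain ⟨J₁, n₁, V₁, hn₁, hsV₁, hagree₁, hgood₁⟩ := ih ((Finset.coe_subset.mpr (Finset.subset_insert b s)).trans hs)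
    have hbZ : b ∈ Z := hs (Finset.mem_coe.mpr (Finset.mem_insert_self b s))
    have hbs' : b ∉ (s : Set X₁) := fun h => hbs (Finset.mem_coe.mp h)
    -- `b ∈ supp J₁` (its stalk is a positive power of the proper `J₀,b`)
    have hbJ₁ : b ∈ (J₁.support : Set X₁) := by
      have h0 := (mem_support_iff_stalkIdeal_le J₀ b).mp (hZsub hbZ)
      exact (mem_support_iff_stalkIdeal_le J₁ b).mpr (by rw [hagree₁ b hbs']; exact pow_le_maximalIdeal_of_le h0 hn₁)
    -- the punctured open `W := (U ∖ (Z ∖ {b})) ∪ V₁ ∋ b`, over which `J₁` is good off `b`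
    have hZbcl : IsClosed (Z \ {b}) := by
      rw [← Set.biUnion_of_singleton (Z \ {b})]
      exact (hZfin.subset Set.sdiff_subset).isClosed_biUnion fun x hx => hZcl x hx.1
    let W : X₁.Opens := ⟨((U : Set X₁) \ (Z \ {b})) ∪ (V₁ : Set X₁), (U.isOpen.sdiff hZbcl).union V₁.isOpen⟩
    have hbW : b ∈ (W : Set X₁) := Or.inl ⟨hJU (hZsub hbZ), fun h => h.2 rfl⟩
    have hWsub : (W : Set X₁) \ {b} ⊆ ((U : Set X₁) \ Z) ∪ (V₁ : Set X₁) := by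
      rintro x ⟨hx, hxb⟩
      rcases hx with ⟨hxU, hxZ⟩ | hxV
      · exact Or.inl ⟨hxU, fun hz => hxZ ⟨hz, hxb⟩⟩
      · exact Or.inr hxV
    obtain ⟨J₂, m, W', hm, hbW', hagree₂, hgood₂⟩ :=
      hfix J₁ b W (hZcl b hbZ) hbJ₁ hbW (RelClosedSubsetFixFinite.goodOver_mono hWsub hgood₁)
    refine ⟨J₂, n₁ * m, V₁ ⊔ W', Nat.mul_pos hn₁ hm, ?_, ?_, ?_⟩
    · intro x hx
      rcases Finset.mem_insert.mp (Finset.mem_coe.mp hx) with rfl | hx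
      · exact Or.inr hbW'
      · exact Or.inl (hsV₁ (Finset.mem_coe.mpr hx))
    · intro x hx
      have hxb : x ≠ b := fun h => hx (Finset.mem_coe.mpr (Finset.mem_insert.mpr (Or.inl h)))
      have hxs : x ∉ (s : Set X₁) := fun h => hx (Finset.mem_coe.mpr (Finset.mem_insert_of_mem (Finset.mem_coe.mp h)))
      rw [hagree₂ x hxb, hagree₁ x hxs, ← pow_mul]
    · -- goodness: transported from `J₁` off `b`, and given over `W' ∋ b`
      obtain ⟨m', rfl⟩ : ∃ m', m = m' + 1 := ⟨m - 1, (Nat.sub_add_cancel hm).symm⟩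
      have ht := RelClosedSubsetFixFinite.goodOver_of_stalkIdeal_eq_pow_off_closed (p := p) (hZcl b hbZ) m' hagree₂ hgood₁
      refine RelClosedSubsetFixFinite.goodOver_mono ?_ (goodOver_union ht hgood₂)
      rintro x (hx | hx)
      · by_cases hxb : x = b
        · exact Or.inr (hxb ▸ hbW')
        · exact Or.inl ⟨Or.inl hx, hxb⟩
      · rcases hx with hx | hx
        · by_cases hxb : x = b
          · exact Or.inr (hxb ▸ hbW')
          · exact Or.inl ⟨Or.inr hx, hxb⟩
        · exact Or.inr hx

/-- **(T3-finʳ) ⟸ (T3ʳ).** [folklore assembly, OURS] -/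
theorem relClosedSubsetFixFiniteR_of_relClosedFixR (h : RelClosedFixR) : RelClosedSubsetFixFiniteR := by
  intro p hp k _ _ X₁ f₁ hs hft hqc hi h4 hCM J₀ Z U hZcl hZfin hZsub hJU hgood
  haveI : IsLocallyNoetherian X₁ := LocallyOfFiniteType.isLocallyNoetherian f₁
  haveI : JacobsonSpace X₁ := LocallyOfFiniteType.jacobsonSpace f₁
  obtain ⟨s, rfl⟩ := hZfin.exists_finset_coe
  have hcl : ∀ b ∈ (s : Set X₁), IsClosed ({b} : Set X₁) := fun b hb =>
    RelClosedSubsetFixFinite.isClosed_singleton_of_mem_finite_isClosed hZcl hZfin hb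
  obtain ⟨J, n, V, hn, hsV, hagree, hgoodJ⟩ := iterate (p := p)
    (fun J₀' b W hb hbJ hbW hW => h p hp k X₁ f₁ hs hft hqc hi h4 hCM J₀' b W hb hbJ hbW hW) J₀ _ U hcl hZfin hZsub hJU hgood s
    subset_rfl
  refine ⟨J, n, hn, hagree, RelClosedSubsetFixFinite.goodOver_mono ?_ hgoodJ⟩
  intro x hx
  by_cases hxZ : x ∈ (s : Set X₁)
  · exact Or.inr (hsV hxZ)
  · exact Or.inl ⟨hx, hxZ⟩

/-! ## §3 FC″ at a non-closed bad point whose spread residual is finite -/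

/-- [OURS · CANDIDATE statement, not a fact] **FC″(dim ≥ 4) at a non-closed bad point whose (A′) datum spreads with a FINITE residual,
repaired currency**: `FCUnguardedRungs.FCUnguardedDimGe4` VERBATIM with the finite-residual hypothesis inserted before the conclusion (no
dimension guard). A WEAKENING of the residual `FCUnguardedDimGe4` (`fcUnguardedOfFiniteResidualR_of_fcUnguardedDimGe4`); PROVED below from
(T3-finʳ). [candidate statement, OURS] -/
@[conjecture] def FCUnguardedOfFiniteResidualR : Prop :=
  ∀ (p : ℕ), p.Prime → ∀ (k : Type) [Field k] [CharP k p]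
    (X₁ : Scheme.{0}) (f₁ : X₁ ⟶ Spec (.of k)),
      IsSeparated f₁ → LocallyOfFiniteType f₁ → QuasiCompact f₁ → IsIntegral X₁ → 4 ≤ topologicalKrullDim X₁ →
      (∀ x : X₁, (∀ d : ℕ, ringKrullDim (X₁.presheaf.stalk x) = d → ∀ s : Fin d → X₁.presheaf.stalk x,
        (Ideal.span (Set.range s)).radical.IsMaximal → RingTheory.Sequence.IsWeaklyRegular (X₁.presheaf.stalk x) (List.ofFn s))) →
      ∀ η : X₁, (¬ IsClosed ({η} : Set X₁) ∧ ¬ (∀ d : ℕ, ringKrullDim (X₁.presheaf.stalk η) = d → ∀ s : Fin d → X₁.presheaf.stalk η,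
          (Ideal.span (Set.range s)).radical.IsMaximal → ∀ t : X₁.presheaf.stalk η, (∃ e : ℕ, t ^ p ^ e ∈
            Ideal.span ((fun z : X₁.presheaf.stalk η => z ^ p ^ e) '' (Ideal.span (Set.range s) : Set (X₁.presheaf.stalk η)))) →
              t ∈ Ideal.span (Set.range s)) ∧
        ∀ y : X₁, y ⤳ η → y ≠ η → (∀ d : ℕ, ringKrullDim (X₁.presheaf.stalk y) = d → ∀ s : Fin d → X₁.presheaf.stalk y,
          (Ideal.span (Set.range s)).radical.IsMaximal → ∀ t : X₁.presheaf.stalk y, (∃ e : ℕ, t ^ p ^ e ∈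
            Ideal.span ((fun z : X₁.presheaf.stalk y => z ^ p ^ e) '' (Ideal.span (Set.range s) : Set (X₁.presheaf.stalk y)))) →
              t ∈ Ideal.span (Set.range s))) →
      -- FINITE-RESIDUAL HYPOTHESIS (repaired currency): an (A′) datum `c′` at η spreads to `J₀`, good over the OPEN `V ⊇ supp J₀` off a
      -- finite closed `Z ⊆ supp J₀` not containing η
      (∃ (n' : ℕ) (c' : Fin n' → X₁.presheaf.stalk η) (J₀ : X₁.IdealSheafData) (V : X₁.Opens) (Z : Set X₁),
        LocFixData p X₁ η n' c' ∧ stalkIdeal J₀ η = Ideal.span (Set.range c') ∧ IsClosed Z ∧ Z.Finite ∧ η ∉ Z ∧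
          Z ⊆ (J₀.support : Set X₁) ∧ (J₀.support : Set X₁) ⊆ (V : Set X₁) ∧ GoodOver p X₁ J₀ ((V : Set X₁) \ Z)) →
      ∃ (J : X₁.IdealSheafData) (n' : ℕ) (c' : Fin n' → X₁.presheaf.stalk η), J ≠ ⊥ ∧ η ∈ (J.support : Set X₁) ∧
      -- the RE-CHOSEN LocFix datum c' at η (currency (A′)): nonzero, inside 𝔪_η, charts FULL over 𝔪_η
      Ideal.span (Set.range c') ≠ ⊥ ∧ Ideal.span (Set.range c') ≤ maximalIdeal (X₁.presheaf.stalk η) ∧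
        (∀ (j : Fin n') (𝔔 : PrimeSpectrum (blowupAlgebra (Ideal.span (Set.range c')) (c' j))),
          𝔔.asIdeal.comap (algebraMap (X₁.presheaf.stalk η) (blowupAlgebra (Ideal.span (Set.range c')) (c' j))) =
            maximalIdeal (X₁.presheaf.stalk η) →
          IsDomain (Localization.AtPrime 𝔔.asIdeal) ∧ ∀ d : ℕ, ringKrullDim (Localization.AtPrime 𝔔.asIdeal) = d →
            ∀ s : Fin d → Localization.AtPrime 𝔔.asIdeal, (Ideal.span (Set.range s)).radical.IsMaximal →
              RingTheory.Sequence.IsWeaklyRegular (Localization.AtPrime 𝔔.asIdeal) (List.ofFn s) ∧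
              ∀ y : Localization.AtPrime 𝔔.asIdeal, (∃ e : ℕ, y ^ p ^ e ∈ Ideal.span ((fun z : Localization.AtPrime 𝔔.asIdeal => z ^ p ^ e) ''
                (Ideal.span (Set.range s) : Set (Localization.AtPrime 𝔔.asIdeal)))) → y ∈ Ideal.span (Set.range s)) ∧
      stalkIdeal J η = Ideal.span (Set.range c') ∧
      (∀ (X₂ : Scheme.{0}) (π : X₂ ⟶ X₁), IsBlowup π J →
        (∀ x : X₂, π.base x ∈ (J.support : Set X₁) → π.base x ≠ η → ¬ IsClosed ({x} : Set X₂) →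
          IsDomain (X₂.presheaf.stalk x) ∧ ∀ d : ℕ, ringKrullDim (X₂.presheaf.stalk x) = d → ∀ s : Fin d → X₂.presheaf.stalk x,
            (Ideal.span (Set.range s)).radical.IsMaximal → RingTheory.Sequence.IsWeaklyRegular (X₂.presheaf.stalk x) (List.ofFn s) ∧
            ∀ t : X₂.presheaf.stalk x, (∃ e : ℕ, t ^ p ^ e ∈ Ideal.span ((fun z : X₂.presheaf.stalk x => z ^ p ^ e) ''
              (Ideal.span (Set.range s) : Set (X₂.presheaf.stalk x)))) → t ∈ Ideal.span (Set.range s)) ∧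
        (∀ x : X₂, π.base x ∈ (J.support : Set X₁) → IsClosed ({x} : Set X₂) →
          ∀ d : ℕ, ringKrullDim (X₂.presheaf.stalk x) = d → ∀ s : Fin d → X₂.presheaf.stalk x,
            (Ideal.span (Set.range s)).radical.IsMaximal → RingTheory.Sequence.IsWeaklyRegular (X₂.presheaf.stalk x) (List.ofFn s)))

/-- **FC″ AT A FINITE-RESIDUAL POINT ⟸ (T3-finʳ)**: the finite fix gives `J ≡ J₀ⁿ` off `Z` good over `V ⊇ supp J`; at `η ∉ Z`,
`J_η = (c′)ⁿ`, whose (A′) datum is the MONOMIAL datum of degree `n` in `c′` (res-L1-w45a-stub-3's `FCUnguardedLocDimLe3.locFixData_pow`: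
the degree-`n` monomial charts are open pieces of the charts of `(c′)`). [folklore assembly, OURS] -/
theorem fcUnguardedOfFiniteResidualR_of_finiteR (h₃ : RelClosedSubsetFixFiniteR) : FCUnguardedOfFiniteResidualR := by
  intro p hp k _ _ X₁ f₁ hs hft hqc hi h4 hCM η _ hres
  obtain ⟨n', c', J₀, V, Z, hdat, hstalk, hZcl, hZfin, hηZ, hZsub, hJV, hgood⟩ := hres
  haveI := hi
  obtain ⟨J, n, hn, hJeq, hJgood⟩ := h₃ p hp k X₁ f₁ hs hft hqc hi h4 hCM J₀ Z V hZcl hZfin hZsub hJV hgood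
  obtain ⟨m, rfl⟩ : ∃ m, n = m + 1 := ⟨n - 1, (Nat.sub_add_cancel hn).symm⟩
  -- the monomial datum for `(c′)^(m+1) = J_η`
  haveI : IsReduced (X₁.presheaf.stalk η) := inferInstance
  obtain ⟨hdat', hspan⟩ := FCUnguardedLocDimLe3.locFixData_pow hdat m
  have hJη : stalkIdeal J η = Ideal.span (Set.range fun t : Fin (n' ^ (m + 1)) => ∏ i, c' (finFunctionFinEquiv.symm t i)) := by
    rw [hJeq η hηZ, hstalk, hspan]
  obtain ⟨hne, hle, hcharts⟩ := hdat'
  -- `supp J = supp J₀` pointwise off `Z`, and on `Z`; so `supp J ⊆ V`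
  have hsuppJ : (J.support : Set X₁) ⊆ (V : Set X₁) := by
    intro x hx
    by_cases hxZ : x ∈ Z
    · exact hJV (hZsub hxZ)
    · have hle0 := (mem_support_iff_stalkIdeal_le J x).mp hx
      rw [hJeq x hxZ] at hle0
      refine hJV ((mem_support_iff_stalkIdeal_le J₀ x).mpr (le_maximalIdeal fun htop => ?_))
      rw [htop, Ideal.top_pow] at hle0
      exact (maximalIdeal.isMaximal _).ne_top (top_le_iff.mp hle0)
  refine ⟨J, _, _, ?_, ?_, hne, hle, hcharts, hJη, fun X₂ π hπ => ?_⟩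
  · -- `J ≠ ⊥` since `J_η = (monomials) ≠ ⊥`
    intro hJ
    apply hne
    rw [← hJη, hJ]
    exact stalkIdeal_bot η
  · -- `η ∈ supp J`
    exact (mem_support_iff_stalkIdeal_le J η).mpr (by rw [hJη]; exact hle)
  · obtain ⟨hnc, hcl⟩ := RelClosedSubsetFixFinite.goodOver_mono hsuppJ hJgood X₂ π hπ
    exact ⟨fun x hx _ hxcl => hnc x hx hxcl, fun x hx hxcl => hcl x hx hxcl⟩

/-- **FC″ AT A FINITE-RESIDUAL POINT ⟸ (T3ʳ)** (via the finite iteration). [folklore assembly, OURS] -/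
theorem fcUnguardedOfFiniteResidualR_of_relClosedFixR (h : RelClosedFixR) : FCUnguardedOfFiniteResidualR :=
  fcUnguardedOfFiniteResidualR_of_finiteR (relClosedSubsetFixFiniteR_of_relClosedFixR h)

/-- Sanity: the finite-residual statement is a weakening of the residual `FCUnguardedDimGe4` (an honest case of FC″). [plumbing] -/
theorem fcUnguardedOfFiniteResidualR_of_fcUnguardedDimGe4 (h : FCUnguardedRungs.FCUnguardedDimGe4) : FCUnguardedOfFiniteResidualR :=
  fun p hp k _ _ X₁ f₁ hs hft hqc hi h4 hCM η hη _ => h p hp k X₁ f₁ hs hft hqc hi h4 hCM η hη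

/-- The weak-currency finite-residual statement (p572611's `FCUnguardedFiniteResidual.FCUnguardedOfFiniteResidual`, hypothesis
`GoodOver J₀ (supp J₀ ∩ U)`) IMPLIES the repaired one: given `V ⊇ supp J₀` open, `Z` finite closed, `J₀` good over `V ∖ Z`, take
`U := V ∖ Z` (open), which contains `η` and `supp J₀ ∖ Z`. (A weaker hypothesis makes the ∀-statement stronger.) [plumbing] -/
theorem fcUnguardedOfFiniteResidualR_of_finiteResidual (h : FCUnguardedFiniteResidual.FCUnguardedOfFiniteResidual) :
    FCUnguardedOfFiniteResidualR := by
  intro p hp k _ _ X₁ f₁ hs hft hqc hi h4 hCM η hη hres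
  obtain ⟨n', c', J₀, V, Z, hdat, hstalk, hZcl, hZfin, hηZ, hZsub, hJV, hgood⟩ := hres
  refine h p hp k X₁ f₁ hs hft hqc hi h4 hCM η hη ⟨n', c', J₀, ⟨(V : Set X₁) \ Z, V.isOpen.sdiff hZcl⟩, hdat, hstalk, ?_, ?_, ?_⟩
  · -- `η ∈ V ∖ Z` (`η ∈ supp J₀` because `J₀,η = (c′) ≤ 𝔪_η`)
    refine ⟨hJV ((mem_support_iff_stalkIdeal_le J₀ η).mpr ?_), hηZ⟩
    rw [hstalk]
    exact hdat.2.1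
  · exact RelClosedSubsetFixFinite.goodOver_mono (fun x hx => hx.2) hgood
  · refine hZfin.subset ?_
    rintro x ⟨hxJ, hxU⟩
    by_contra hxZ
    exact hxU ⟨hJV hxJ, hxZ⟩

end Summit.ResolutionOfSingularities.ResolutionOfSingularities.Theorems.FInjectiveMacaulayfication.RelClosedFixR

end
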